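import Summits.QuantumFields.YangMills.Theorems.BalabanUVNodesN07TowerCentresCoverPointwise
import Literature.MathematicalPhysics.QuantumFieldTheory.Balaban1983to89.B8ExpMeanLogCrossTermCellRec
import Literature.MathematicalPhysics.QuantumFieldTheory.Balaban1983to89.Node00.Record11
import HarnessLib

/-!
# N07 [B11] (= [15] = [Balaban1985Variational]) Sect. F ∕ [I] (0.1)–(0.4) ∕ [3] (78), (167) — **THE TORUS TOWER STATEMENT, LIFTED, IS THE `ℤᵈ` CELL LEMMA's `hptτ` ROW BY NAME**:
# `SU(N) ↪ M_N(ℂ)ˣ` one-liners + the schedule monotonicity + the composed `U1`∕oscillation rows and the composed cross-term cell bound for the lifted torus transformation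

Cell `pub-ymgap`, width seat `pub-ymgap-dag-n07-w3` g13 (junction side of the K0 road; (σ2) glue).  `--kind proof --supports stmt-QuantumFields-20541 --as helper` (K0⁷; count-neutral;
THEOREMS ONLY, 0 `def`).  [I] = [Balaban1987RG1]; [3] = [Balaban1985Averaging]; [6] = [Balaban1985RegularSpaces]; [15] = [Balaban1985Variational].  CONSUMED BY NAME: this seat's
✓p756357 `…N07TowerCentresCoverPointwise.pointwise_osc_lift_of_torus`, ✓p753816 `B8ExpMeanLogOscFromPointwiseRec.{osc_rows_of_pointwise_under, uavgZ_one_unitary_and_near_centre_under}`,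
✓p755807 `B8ExpMeanLogCrossTermCellRec.norm_uavgZ_one_mul_inv_mul_sub_one_le_of_pointwise`, NODE 00's `Record11.{ιSU, coe_ιSU, MatA, SU}`, dag-n05-d's `B8Eq119TwistedAxialRec.UnderZ`,
`B8BlockConstantLiftStabilityRec.underZ_add`, `B7Prop2Explicit.unitaryUnits`.

WHY.  The junction's first cross-term factor is the top-anchored LIFT `τ(x) := ιSU(τ_T(π(x + c_k·𝟙)))` of the torus transformation `τ_T = (h̄_s·w_s)·(h̄_r·w_r)⁻¹`.  Its pointwise
multiscale oscillation is proved ON THE TORUS (this seat's ✓p756047 `…N07TwoAxialTowersPointwiseOsc.dist1_descent_le_geom`: «`∀ t ≤ k, ∀ w ∈ S, dist1 (τ_T(embIter t (iterBlockOf t w))⁻¹·τ_T(w))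
≤ ω·θ^{k−t}`»), read on the cover by ✓p756357 (`dist1 (τ_T(π(L^{i+1}·z + c_k·𝟙))⁻¹·τ_T(π(w_Z + c_k·𝟙))) ≤ B (i+1)`), and CONSUMED on `ℤᵈ` in `M_N(ℂ)ˣ`-currency by ✓p753816 ∕ ✓p755807
(«`‖τ(L^{i+1}·z)⁻¹·τ(w_Z) − 1‖ ≤ ω·θ^{j′−(i+1)}` for `z` under the cell anchor `y` at depth `j′ − (i+1)` and `w_Z` under `z`»).  THIS FILE supplies the three pieces of glue between the
typings and composes them: (a) `‖(ιSU a)⁻¹·ιSU b − 1‖ = dist1 (a⁻¹·b)` (`coe_ιSU` + the `SU(N)` instance's `dist1`, both `rfl`); (b) the lift is unitary-valued (the `hτ` binder);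
(c) the fine sites under a level-`j′` cell anchor lie under it at depth `j′ = (j′ − (i+1)) + (i+1)` (`underZ_add`), so a cell whose fine shadow covers into `S` inherits the tower statement,
and the top-relative schedule `ω·θ^{k−(i+1)}` is below the cell-relative `ω·θ^{j′−(i+1)}` for `j′ ≤ k`, `0 ≤ θ ≤ 1`.  Pure typing∕bookkeeping: NO estimate of [I]∕[3]∕[6]∕[15] is asserted.

WHAT IS PROVED (sorry-free; every `Params`; `N ≥ 1`).
§1 `norm_coe_ιSU_sub_one_eq_dist1`, `norm_coe_ιSU_inv_mul_sub_one_eq_dist1` (`rfl`-level dictionary `SU(N)` ↔ `M_N(ℂ)ˣ`), `ιSU_mem_unitaryUnits'`, `lift_mem_unitaryUnits_under` (the `hτ`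
   binder of ✓p753816∕✓p755807 for the anchored lift), `geom_schedule_mono` (`ω·θ^{k−(i+1)} ≤ ω·θ^{j′−(i+1)}` for `j′ ≤ k`).
§2 ★★★ `hpt_lift_of_torus_tower` — the torus tower statement «`∀ t ≤ k, ∀ w ∈ S, dist1 (τ_T(embIter t (iterBlockOf t w))⁻¹·τ_T(w)) ≤ B t`» + «the fine shadow of the cell anchor `y`
   (depth `j′ ≤ k`) covers into `S`» + the schedule «`B (i+1) ≤ ω·θ^{j′−(i+1)}` for `i < j′`» give VERBATIM the `hpt`∕`hptτ` binder of ✓p753816∕✓p755807 for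
   `τ := fun x => ιSU N (τ_T (π(x + c_k·𝟙)))` at `(j′, y)`; `hpt_lift_of_torus_tower_geom` — the same with `B t := ω·θ^{k−t}` (✓p756047's output shape) and no schedule binder.
§3 ★★ `osc_rows_lift_of_torus_tower` ∕ `unitary_and_near_centre_lift_of_torus_tower` — §2 + §1 fed to ✓p753816 BY NAME: the (78)-family rows
   `‖R̄₀ⁱτ(L·z)⁻¹·R̄₀ⁱτ(x) − 1‖ ≤ 4ω·θ^{j′−(i+1)}` and the unitarity ∕ near-centre rows of the iterated unit-lattice averages of the lifted `τ` under the cell (`θ ≤ 1∕8`, `ω ≤ 1∕128`).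
§4 ★★★ `norm_uavgZ_one_lift_mul_inv_mul_sub_one_le_of_torus_tower` — ✓p755807's ONE-CALL cell bound `‖R̄₀^{j′}(τ·h⁻¹·u)(y) − 1‖ ≤ 1024·(4(ω_τ + ω_u))²` with the `τ`-side binders
   (`hτ`, `hptτ`) DISCHARGED from the torus tower statement; the `u`-side (`hu`, `hptu`, `hu1`), `h ≡ R̄₀^{j′}τ(y)` under `y` and the numerics stay displayed.
HONEST FRAMING: count-neutral helper; typing∕cover bookkeeping and three compositions — nothing of [I]∕[3]∕[6]∕[15] asserted or discharged; the torus tower statement, the `u₀`-side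
letters ((σ1)) and `h`'s block-constancy remain DISPLAYED hypotheses of the junction's knit; `NrmSymPhiOfRecord` ∕ `HThm4RecSym152PhiE(G)` ∕ `HThm4Rec*` UNDISCHARGED; N05 ∕ N07 NOT
discharged; K0⁷ ∕ K1⁹ NOT closed; counts unmoved (typed 28∕28 · discharged 8∕28); one finite 𝕋⁴ programme at fixed ε — R4 closes the conditional finite-𝕋⁴ rung `BalabanLadder.UV` only;
the YM mass gap (Clay) is NOT proved by any of this; nothing continuum ∕ ℝ⁴ ∕ OS.  No `def`, no `instance`, no `notation`, no `sorry`.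

References: [I] (0.1) p. 251, (0.3)–(0.4) pp. 252–253; [3] (78)–(81) p. 30, (167) p. 44; [6] (1.19) p. 79, (1.29) p. 81; [15] (147) p. 301.
-/

set_option autoImplicit false

noncomputable section

open scoped BigOperators Matrix.Norms.L2Operator

namespace Summit.QuantumFields.YangMills.BalabanUVNodes.N07TowerOscCoverBridge

open Literature.MathematicalPhysics.QuantumFieldTheory.Balaban1983to89
open Literature.MathematicalPhysics.QuantumFieldTheory.Balaban1983to89.Node00
open BlockAveragingZd (ctrShift)
open B8Eq119TwistedAxialRec (UnderZ)
open B8BlockConstantLiftStabilityRec (underZ_add)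
open B15Eq112TorusCover (cover)
open B14DomainGeom (Pt)
open B5Eq118OneStroke (iterBlockOf)
open B15DeterminingSets (embIter)
open B7Prop2Explicit (unitaryUnits mem_unitaryUnits)
open B7SectCDGaugeAveragesRec (uavgZ)
open B7SectEFLinearisationRec (blockSitesZ)
open B8ExpMeanLogOscFromPointwiseRec (osc_rows_of_pointwise_under uavgZ_one_unitary_and_near_centre_under)
open B8ExpMeanLogCrossTermCellRec (norm_uavgZ_one_mul_inv_mul_sub_one_le_of_pointwise)
open N07TowerCentresCoverPointwise (pointwise_osc_lift_of_torus)

variable {P : Params} (N : ℕ) [NeZero N]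

/-! ## §1  `SU(N) ↪ M_N(ℂ)ˣ` one-liners, unitarity of the lift, schedule monotonicity -/

/-- `‖ιSU g − 1‖ = dist1 g`: the embedded matrix IS the matrix (`coe_ιSU`) and the `SU(N)` instance's `dist1` IS the operator-norm distance to `1`. [cite: Balaban1987RG1, pp.251–252 (bookkeeping)] -/
theorem norm_coe_ιSU_sub_one_eq_dist1 (g : SU N) : ‖((ιSU N g : (MatA N)ˣ) : MatA N) - 1‖ = dist1 g := rfl

/-- `‖(ιSU a)⁻¹·ιSU b − 1‖ = dist1 (a⁻¹·b)` (`ιSU` is a monoid hom). [cite: Balaban1987RG1, pp.251–252 (bookkeeping)] -/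
theorem norm_coe_ιSU_inv_mul_sub_one_eq_dist1 (a b : SU N) :
    ‖((((ιSU N a)⁻¹ * ιSU N b : (MatA N)ˣ)) : MatA N) - 1‖ = dist1 (a⁻¹ * b) := by
  rw [← map_inv, ← map_mul]; rfl

omit [NeZero N] in
/-- The embedded `SU(N)` matrix is a unitary unit of `M_N(ℂ)` (as `…N07DatumCrownSideConditions.ιSU_mem_unitaryUnits`, restated here to keep this glue file's imports light).
[cite: Balaban1987RG1, pp.251–252 («G ⊂ U(N)»)] -/
theorem ιSU_mem_unitaryUnits' (g : SU N) :
    letI : CStarAlgebra (MatA N) := {}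
    ιSU N g ∈ unitaryUnits (MatA N) := by
  letI : CStarAlgebra (MatA N) := {}
  exact mem_unitaryUnits.mpr (by rw [coe_ιSU]; exact Matrix.specialUnitaryGroup_le_unitaryGroup g.2)

omit [NeZero N] in
/-- **THE `hτ` BINDER**: the top-anchored lift `x ↦ ιSU(τ_T(π(x + c_k·𝟙)))` of an `SU(N)`-valued torus function is unitary-valued under every cell (indeed everywhere).
[cite: Balaban1985Averaging, (167) p.44 (bookkeeping); Balaban1987RG1, pp.251–253] -/
theorem lift_mem_unitaryUnits_under (τ : Site P 0 → SU N) (k j : ℕ) (y : Pt P.d) :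
    letI : CStarAlgebra (MatA N) := {}
    ∀ x, UnderZ P.L j y x → (fun x => ιSU N (τ (cover P (x + fun _ => ((ctrShift P.L k : ℕ) : ℤ))))) x ∈ unitaryUnits (MatA N) :=
  fun _ _ => ιSU_mem_unitaryUnits' N _

/-- **SCHEDULE MONOTONICITY**: the top-relative geometric schedule is below the cell-relative one — `ω·θ^{k−(i+1)} ≤ ω·θ^{j′−(i+1)}` for `j′ ≤ k`, `0 ≤ θ ≤ 1`, `0 ≤ ω`. [folklore] -/
theorem geom_schedule_mono {k j i : ℕ} (hjk : j ≤ k) {ω θ : ℝ} (hθ0 : 0 ≤ θ) (hθ1 : θ ≤ 1) (hω0 : 0 ≤ ω) :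
    ω * θ ^ (k - (i + 1)) ≤ ω * θ ^ (j - (i + 1)) :=
  mul_le_mul_of_nonneg_left (pow_le_pow_of_le_one hθ0 hθ1 (by omega)) hω0

/-! ## §2  The torus tower statement IS the `hpt` row of the lift -/

/-- ★★★ **`hpt` OF THE LIFT FROM THE TORUS TOWER STATEMENT** — for an `SU(N)`-valued `τ_T` on the fine torus, a fine site set `S`, a bound `B` with the tower statement
`dist1 (τ_T(embIter t (iterBlockOf t w))⁻¹·τ_T(w)) ≤ B t` (`t ≤ k`, `w ∈ S`), a cell anchor `y` at depth `j′ ≤ k` whose fine shadow covers into `S`, and the schedule `B (i+1) ≤ ω·θ^{j′−(i+1)}`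
(`i < j′`): the lift `τ := ιSU ∘ τ_T ∘ π ∘ (· + c_k·𝟙)` satisfies, VERBATIM, the `hpt` ∕ `hptτ` binder of ✓p753816 `osc_rows_of_pointwise_under` ∕ ✓p755807
`norm_uavgZ_one_mul_inv_mul_sub_one_le_of_pointwise` at `(j′, y)`. [cite: Balaban1987RG1, (0.1) p.251, (0.3) p.252; Balaban1985Averaging, (167) p.44; Balaban1985RegularSpaces, (1.19) p.79; Balaban1985Variational, (147) p.301] -/
theorem hpt_lift_of_torus_tower {k : ℕ} (hk : k ≤ P.m + P.K) (τ : Site P 0 → SU N) (S : Set (Site P 0)) (B : ℕ → ℝ)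
    (hT : ∀ t, t ≤ k → ∀ w ∈ S, dist1 ((τ (embIter t (iterBlockOf t w)))⁻¹ * τ w) ≤ B t)
    {j : ℕ} (hjk : j ≤ k) (y : Pt P.d) (hyS : ∀ w, UnderZ P.L j y w → cover P (w + fun _ => ((ctrShift P.L k : ℕ) : ℤ)) ∈ S)
    {ω θ : ℝ} (hB : ∀ i, i < j → B (i + 1) ≤ ω * θ ^ (j - (i + 1))) :
    ∀ i, i < j → ∀ z, UnderZ P.L (j - (i + 1)) y z → ∀ w, UnderZ P.L (i + 1) z w →
      ‖(((((fun x => ιSU N (τ (cover P (x + fun _ => ((ctrShift P.L k : ℕ) : ℤ))))) (((P.L : ℤ) ^ (i + 1)) • z))⁻¹ *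
          (fun x => ιSU N (τ (cover P (x + fun _ => ((ctrShift P.L k : ℕ) : ℤ))))) w : (MatA N)ˣ)) : MatA N) - 1‖ ≤ ω * θ ^ (j - (i + 1)) := by
  intro i hi z hz w hw
  have hyw : UnderZ P.L j y w := by
    have h := underZ_add P.hL.1 hz hw
    rwa [Nat.sub_add_cancel (by omega : i + 1 ≤ j)] at h
  have h := pointwise_osc_lift_of_torus hk τ S B hT (lt_of_lt_of_le hi hjk) z hw (hyS w hyw)
  rw [← norm_coe_ιSU_inv_mul_sub_one_eq_dist1] at h
  exact h.trans (hB i hi)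

/-- ★★ **The same with ✓p756047's output shape** `B t := ω·θ^{k−t}` (top-relative schedule): no schedule binder, `0 ≤ θ ≤ 1`, `0 ≤ ω`, `j′ ≤ k`.
[cite: Balaban1987RG1, (0.1) p.251, (0.3) p.252; Balaban1985Averaging, (167) p.44; Balaban1985Variational, (147) p.301] -/
theorem hpt_lift_of_torus_tower_geom {k : ℕ} (hk : k ≤ P.m + P.K) (τ : Site P 0 → SU N) (S : Set (Site P 0)) {ω θ : ℝ}
    (hθ0 : 0 ≤ θ) (hθ1 : θ ≤ 1) (hω0 : 0 ≤ ω)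
    (hT : ∀ t, t ≤ k → ∀ w ∈ S, dist1 ((τ (embIter t (iterBlockOf t w)))⁻¹ * τ w) ≤ ω * θ ^ (k - t))
    {j : ℕ} (hjk : j ≤ k) (y : Pt P.d) (hyS : ∀ w, UnderZ P.L j y w → cover P (w + fun _ => ((ctrShift P.L k : ℕ) : ℤ)) ∈ S) :
    ∀ i, i < j → ∀ z, UnderZ P.L (j - (i + 1)) y z → ∀ w, UnderZ P.L (i + 1) z w →
      ‖(((((fun x => ιSU N (τ (cover P (x + fun _ => ((ctrShift P.L k : ℕ) : ℤ))))) (((P.L : ℤ) ^ (i + 1)) • z))⁻¹ *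
          (fun x => ιSU N (τ (cover P (x + fun _ => ((ctrShift P.L k : ℕ) : ℤ))))) w : (MatA N)ˣ)) : MatA N) - 1‖ ≤ ω * θ ^ (j - (i + 1)) :=
  hpt_lift_of_torus_tower N hk τ S (fun t => ω * θ ^ (k - t)) hT hjk y hyS
    (fun _ _ => geom_schedule_mono hjk hθ0 hθ1 hω0)

/-! ## §3  Composition with ✓p753816: the `U1` and oscillation rows of the lifted `τ` under the cell -/

/-- ★★ **(78)-FAMILY ROWS OF THE LIFT FROM THE TORUS TOWER STATEMENT** — §2 + §1 fed to ✓p753816 `osc_rows_of_pointwise_under` BY NAME: for `θ ≤ 1∕8`, `ω ≤ 1∕128`,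
`‖R̄₀ⁱτ(L·z)⁻¹·R̄₀ⁱτ(x) − 1‖ ≤ 4ω·θ^{j′−(i+1)}` for every `i < j′`, `z` under `y` at depth `j′ − (i+1)` and `x` in the block of `z`.
[cite: Balaban1985Averaging, (78)–(81) p.30, (167) p.44; Balaban1987RG1, (0.3)–(0.4) pp.252–253; Balaban1985Variational, (147) p.301] -/
theorem osc_rows_lift_of_torus_tower {k : ℕ} (hk : k ≤ P.m + P.K) (τ : Site P 0 → SU N) (S : Set (Site P 0)) (B : ℕ → ℝ)
    (hT : ∀ t, t ≤ k → ∀ w ∈ S, dist1 ((τ (embIter t (iterBlockOf t w)))⁻¹ * τ w) ≤ B t)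
    {j : ℕ} (hjk : j ≤ k) (y : Pt P.d) (hyS : ∀ w, UnderZ P.L j y w → cover P (w + fun _ => ((ctrShift P.L k : ℕ) : ℤ)) ∈ S)
    {ω θ : ℝ} (hθ0 : 0 ≤ θ) (hθ : θ ≤ 1 / 8) (hω0 : 0 ≤ ω) (hω : ω ≤ 1 / 128) (hB : ∀ i, i < j → B (i + 1) ≤ ω * θ ^ (j - (i + 1))) :
    letI : CStarAlgebra (MatA N) := {}
    ∀ i, i < j → ∀ z, UnderZ P.L (j - (i + 1)) y z → ∀ x ∈ blockSitesZ P.L z,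
      ‖(((uavgZ P.L (1 : Pt P.d → Fin P.d → (MatA N)ˣ) (fun x => ιSU N (τ (cover P (x + fun _ => ((ctrShift P.L k : ℕ) : ℤ))))) i ((P.L : ℤ) • z))⁻¹ : (MatA N)ˣ) : MatA N) *
          ((uavgZ P.L (1 : Pt P.d → Fin P.d → (MatA N)ˣ) (fun x => ιSU N (τ (cover P (x + fun _ => ((ctrShift P.L k : ℕ) : ℤ))))) i x : (MatA N)ˣ) : MatA N) - 1‖ ≤
        4 * ω * θ ^ (j - (i + 1)) := by
  letI : CStarAlgebra (MatA N) := {}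
  exact osc_rows_of_pointwise_under P.hL.1 _ j y hθ0 hθ hω0 hω (lift_mem_unitaryUnits_under N τ k j y)
    (hpt_lift_of_torus_tower N hk τ S B hT hjk y hyS hB)

/-- ★★ **UNITARITY AND NEAR-CENTRE ROWS OF THE LIFT's ITERATED AVERAGES** — §2 + §1 fed to ✓p753816 `uavgZ_one_unitary_and_near_centre_under` BY NAME: under the cell,
`R̄₀ⁱτ(x)` is unitary and `‖τ(Lⁱ·x)⁻¹·R̄₀ⁱτ(x) − 1‖ ≤ 8ω·θ^{j′−i}` (`i ≤ j′`, `x` under `y` at depth `j′ − i`).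
[cite: Balaban1985Averaging, (78)–(81) p.30, (167) p.44; Balaban1987RG1, (0.3)–(0.4) pp.252–253] -/
theorem unitary_and_near_centre_lift_of_torus_tower {k : ℕ} (hk : k ≤ P.m + P.K) (τ : Site P 0 → SU N) (S : Set (Site P 0)) (B : ℕ → ℝ)
    (hT : ∀ t, t ≤ k → ∀ w ∈ S, dist1 ((τ (embIter t (iterBlockOf t w)))⁻¹ * τ w) ≤ B t)
    {j : ℕ} (hjk : j ≤ k) (y : Pt P.d) (hyS : ∀ w, UnderZ P.L j y w → cover P (w + fun _ => ((ctrShift P.L k : ℕ) : ℤ)) ∈ S)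
    {ω θ : ℝ} (hθ0 : 0 ≤ θ) (hθ : θ ≤ 1 / 8) (hω0 : 0 ≤ ω) (hω : ω ≤ 1 / 128) (hB : ∀ i, i < j → B (i + 1) ≤ ω * θ ^ (j - (i + 1))) :
    letI : CStarAlgebra (MatA N) := {}
    ∀ i, i ≤ j → ∀ x, UnderZ P.L (j - i) y x →
      uavgZ P.L (1 : Pt P.d → Fin P.d → (MatA N)ˣ) (fun x => ιSU N (τ (cover P (x + fun _ => ((ctrShift P.L k : ℕ) : ℤ))))) i x ∈ unitaryUnits (MatA N) ∧
        ‖(((((fun x => ιSU N (τ (cover P (x + fun _ => ((ctrShift P.L k : ℕ) : ℤ))))) (((P.L : ℤ) ^ i) • x))⁻¹ *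
            uavgZ P.L (1 : Pt P.d → Fin P.d → (MatA N)ˣ) (fun x => ιSU N (τ (cover P (x + fun _ => ((ctrShift P.L k : ℕ) : ℤ))))) i x : (MatA N)ˣ)) : MatA N) - 1‖ ≤
          8 * ω * θ ^ (j - i) := by
  letI : CStarAlgebra (MatA N) := {}
  exact uavgZ_one_unitary_and_near_centre_under P.hL.1 _ j y hθ0 hθ hω0 hω (lift_mem_unitaryUnits_under N τ k j y)
    (hpt_lift_of_torus_tower N hk τ S B hT hjk y hyS hB)

/-! ## §4  Composition with ✓p755807: the cell's cross-term bound with the `τ`-side discharged from the torus -/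

/-- ★★★ **THE CELL BOUND WITH THE `τ`-SIDE READ FROM THE TORUS TOWER STATEMENT** — ✓p755807 `norm_uavgZ_one_mul_inv_mul_sub_one_le_of_pointwise` with `τ := ιSU ∘ τ_T ∘ π ∘ (· + c_k·𝟙)`,
its `hτ` binder discharged by §1 and its `hptτ` binder by §2: for a cell anchor `y` at depth `j′ ≤ k` whose fine shadow covers into `S`, a pre-composition `h ≡ R̄₀^{j′}τ(y)` under `y`,
a unitary `u` with `R̄₀^{j′}u(y) = 1` and pointwise multiscale oscillation `ω_u·θ^{j′−(i+1)}` under `y` (the (σ1) letters, DISPLAYED), and numerics `θ ≤ 1∕8`, `ω_τ + ω_u ≤ 1∕512`,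
`4096·θ·(ω_τ + ω_u) ≤ 1`: `‖R̄₀^{j′}(τ·h⁻¹·u)(y) − 1‖ ≤ 1024·(4(ω_τ + ω_u))²`.
[cite: Balaban1985Averaging, (78)–(81) p.30, (167) p.44; Balaban1985RegularSpaces, (1.29) p.81; Balaban1987RG1, (0.3)–(0.4) pp.252–253; Balaban1985Variational, (147) p.301] -/
theorem norm_uavgZ_one_lift_mul_inv_mul_sub_one_le_of_torus_tower {k : ℕ} (hk : k ≤ P.m + P.K) (τ : Site P 0 → SU N) (S : Set (Site P 0)) (B : ℕ → ℝ)
    (hT : ∀ t, t ≤ k → ∀ w ∈ S, dist1 ((τ (embIter t (iterBlockOf t w)))⁻¹ * τ w) ≤ B t)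
    {j : ℕ} (hjk : j ≤ k) (y : Pt P.d) (hyS : ∀ w, UnderZ P.L j y w → cover P (w + fun _ => ((ctrShift P.L k : ℕ) : ℤ)) ∈ S)
    {ωτ ωu θ : ℝ} (hθ0 : 0 ≤ θ) (hθ : θ ≤ 1 / 8) (hωτ0 : 0 ≤ ωτ) (hωu0 : 0 ≤ ωu) (hω : ωτ + ωu ≤ 1 / 512) (hθω : 4096 * θ * (ωτ + ωu) ≤ 1)
    (hB : ∀ i, i < j → B (i + 1) ≤ ωτ * θ ^ (j - (i + 1)))
    (h u : Pt P.d → (MatA N)ˣ)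
    (hu : letI : CStarAlgebra (MatA N) := {}; ∀ x, UnderZ P.L j y x → u x ∈ unitaryUnits (MatA N))
    (hh : ∀ x, UnderZ P.L j y x →
      h x = uavgZ P.L (1 : Pt P.d → Fin P.d → (MatA N)ˣ) (fun x => ιSU N (τ (cover P (x + fun _ => ((ctrShift P.L k : ℕ) : ℤ))))) j y)
    (hptu : ∀ i, i < j → ∀ z, UnderZ P.L (j - (i + 1)) y z → ∀ w, UnderZ P.L (i + 1) z w →
      ‖((((u (((P.L : ℤ) ^ (i + 1)) • z))⁻¹ * u w : (MatA N)ˣ)) : MatA N) - 1‖ ≤ ωu * θ ^ (j - (i + 1)))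
    (hu1 : uavgZ P.L (1 : Pt P.d → Fin P.d → (MatA N)ˣ) u j y = 1) :
    ‖((uavgZ P.L (1 : Pt P.d → Fin P.d → (MatA N)ˣ)
        ((fun x => ιSU N (τ (cover P (x + fun _ => ((ctrShift P.L k : ℕ) : ℤ))))) * h⁻¹ * u) j y : (MatA N)ˣ) : MatA N) - 1‖ ≤ 1024 * (4 * (ωτ + ωu)) ^ 2 := by
  letI : CStarAlgebra (MatA N) := {}
  exact norm_uavgZ_one_mul_inv_mul_sub_one_le_of_pointwise P.hL.1 _ h u j y hθ0 hθ hωτ0 hωu0 hω hθω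
    (lift_mem_unitaryUnits_under N τ k j y) hu hh (hpt_lift_of_torus_tower N hk τ S B hT hjk y hyS hB) hptu hu1

end Summit.QuantumFields.YangMills.BalabanUVNodes.N07TowerOscCoverBridge

end
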